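import Literature.MathematicalPhysics.QuantumManyBody.BoseGasHardLayerLines
import Literature.MathematicalPhysics.QuantumManyBody.BoseGasLineGeometry
import Literature.Analysis.FunctionSpaces.TorusPlateauCutoff
import HarnessLib

/-!
# Smooth symmetric periodic cut-offs vanishing near the hard configurations

Topic `Literature/MathematicalPhysics/QuantumManyBody`, sequel of `BoseGasHardLayerLines.lean`, using the plateau cut-offs of
`Literature.Analysis.FunctionSpaces.TorusPlateauCutoff`. For the form-core theorem with hard-core pair potentials one
multiplies smooth periodic Bose-symmetric functions by a cut-off `ξ_s` which kills the hard layer of width `s/2`, is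
`1` off the hard layer of width `s`, and has gradient `O(1/s)`:

* `exists_hardLayer_cutoff` — **for `L > 0` there is `C` such that for every `0 < s ≤ L` there is
  `ξ : (ℝ³)^N → [0, 1]`, `C¹`, torus periodic, permutation symmetric, `ξ = 0` on `hardLayer v L (s/2)`, `ξ = 1` on the
  `s/10`-neighbourhood of the complement of `hardLayer v L s` (so `∇ξ = 0` off `hardLayer v L s`), `‖∇ξ‖ ≤ C/s`.**

Construction: `1 - χ ∘ toUnitTorusN L` for the plateau cut-off `χ` of the torus image of `hardLayer v L (s/2)` at scale
`δ = s/(100 L)` (`Torus.exists_plateau_cutoff`), averaged over the permutations of the particles (`relabelCLM`,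
`single_comp_perm` of `BoseGasProductState.lean`).

Tagged folklore.
-/

noncomputable section

open MeasureTheory Set Metric Filter Topology
open scoped ENNReal ContDiff

namespace Literature.MathematicalPhysics.QuantumManyBody.BoseGas

open Literature.Analysis.FunctionSpaces Literature.Analysis.FunctionSpaces.Torus

variable {N : ℕ} {L : ℝ} {v : ℝ → ℝ≥0∞}

namespace HardLayerAux

/-! ### Geometry of the hard layers -/

/-- The hard layers are permutation symmetric. [folklore] -/
theorem comp_perm_mem_hardLayer_iff (σ : Equiv.Perm (Fin N)) (X : Config N) (s : ℝ) :
    X ∘ σ ∈ (hardLayer v L s : Set (Config N)) ↔ X ∈ hardLayer v L s := by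
  constructor
  · rintro ⟨i, j, n, hij, h⟩
    exact ⟨σ i, σ j, n, fun h' => hij (σ.injective h'), by simpa [pairRad] using h⟩
  · rintro ⟨i, j, n, hij, h⟩
    refine ⟨σ.symm i, σ.symm j, n, fun h' => hij (σ.symm.injective h'), ?_⟩
    simpa [pairRad] using h

/-- Moving every particle by at most `ρ` moves a configuration of `hardLayer v L a` into `hardLayer v L (a + 2ρ)`.
[folklore] -/
theorem mem_hardLayer_of_near {X X' : Config N} {a ρ : ℝ} (hX' : X' ∈ (hardLayer v L a : Set (Config N)))
    (hnear : ∀ i, ‖X i - X' i‖ ≤ ρ) : X ∈ (hardLayer v L (a + 2 * ρ) : Set (Config N)) := by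
  obtain ⟨i, j, n, hij, h⟩ := hX'
  refine ⟨i, j, n, hij, ?_⟩
  have hd : dist (pairRad L X i j n) (pairRad L X' i j n) ≤ 2 * ρ := by
    rw [Real.dist_eq, pairRad, pairRad]
    have h1 := abs_norm_sub_norm_le (X i - X j - latticeVec L n) (X' i - X' j - latticeVec L n)
    have h2 : ‖X i - X j - latticeVec L n - (X' i - X' j - latticeVec L n)‖ ≤ ρ + ρ := by
      rw [show X i - X j - latticeVec L n - (X' i - X' j - latticeVec L n) = (X i - X' i) - (X j - X' j) by abel]
      exact (norm_sub_le _ _).trans (add_le_add (hnear i) (hnear j))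
    linarith
  have := infDist_le_infDist_add_dist (x := pairRad L X i j n) (y := pairRad L X' i j n) (s := hardRad v)
  linarith

/-- Conversely, off `hardLayer v L b` every `ρ`-perturbation (each particle moved by at most `ρ`) stays off
`hardLayer v L (b - 2ρ)`. [folklore] -/
theorem notMem_hardLayer_of_near {X X' : Config N} {b ρ : ℝ} (hX : X ∉ (hardLayer v L b : Set (Config N)))
    (hnear : ∀ i, ‖X' i - X i‖ ≤ ρ) : X' ∉ (hardLayer v L (b - 2 * ρ) : Set (Config N)) := by
  intro h
  have := mem_hardLayer_of_near (v := v) h fun i => by rw [norm_sub_rev]; exact hnear i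
  rw [sub_add_cancel] at this
  exact hX this

/-! ### Lifting torus proximity to configurations -/

/-- Every point of `ℝ/ℤ` has a representative of modulus `‖·‖`. [folklore] -/
theorem exists_coe_eq_abs_eq_norm (w : UnitAddCircle) : ∃ r : ℝ, (r : UnitAddCircle) = w ∧ |r| = ‖w‖ := by
  obtain ⟨x, rfl⟩ := QuotientAddGroup.mk_surjective w
  refine ⟨x - round x, ?_, ?_⟩
  · show ((x - round x : ℝ) : UnitAddCircle) = (x : UnitAddCircle)
    rw [AddCircle.coe_sub, sub_eq_self, AddCircle.coe_eq_zero_iff]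
    exact ⟨round x, by simp⟩
  · show |x - round x| = ‖((x : ℝ) : UnitAddCircle)‖
    rw [AddCircle.norm_eq]
    simp

/-- **Lifting torus proximity**: if `toUnitTorusN L X` is within `ρ` of `t'` (sup metric of `(ℝ/ℤ)^{3N}`), then `t'`
has a lift `X'` each of whose particles is within `2Lρ` of the corresponding particle of `X`. [folklore] -/
theorem exists_lift_near (hL : 0 < L) (X : Config N) {t' : UnitAddTorus (Fin N × Fin 3)} {ρ : ℝ} (hρ : 0 < ρ)
    (h : dist (toUnitTorusN L X) t' < ρ) :
    ∃ X' : Config N, toUnitTorusN L X' = t' ∧ ∀ i, ‖X i - X' i‖ < 2 * L * ρ := by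
  choose r hr using fun p : Fin N × Fin 3 => exists_coe_eq_abs_eq_norm (toUnitTorusN L X p - t' p)
  have hrρ : ∀ p, |r p| < ρ := fun p => by
    rw [(hr p).2, ← dist_eq_norm]
    exact (dist_pi_lt_iff hρ).1 h p
  refine ⟨fun i => X i - WithLp.toLp 2 (fun k : Fin 3 => L * r (i, k)), ?_, fun i => ?_⟩
  · funext p
    rw [toUnitTorusN_apply]
    simp only [PiLp.sub_apply]
    rw [show (X p.1 p.2 - L * r (p.1, p.2)) / L = X p.1 p.2 / L - r p by rw [Prod.mk.eta]; field_simp,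
      AddCircle.coe_sub, (hr p).1, ← toUnitTorusN_apply, sub_sub_cancel]
  · show ‖X i - (X i - WithLp.toLp 2 (fun k : Fin 3 => L * r (i, k)))‖ < 2 * L * ρ
    rw [sub_sub_cancel]
    have hsq : ‖WithLp.toLp 2 (fun k : Fin 3 => L * r (i, k))‖ ^ 2 < (2 * L * ρ) ^ 2 := by
      rw [EuclideanSpace.norm_sq_eq]
      simp only [Real.norm_eq_abs, sq_abs, Fin.sum_univ_three]
      have h3 : ∀ k, (L * r (i, k)) ^ 2 < (L * ρ) ^ 2 := fun k => by
        rw [mul_pow, mul_pow]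
        exact mul_lt_mul_of_pos_left (sq_lt_sq' (by linarith [(abs_lt.1 (hrρ (i, k))).1]) (abs_lt.1 (hrρ (i, k))).2)
          (by positivity)
      nlinarith [h3 0, h3 1, h3 2, mul_pos hL hρ]
    exact lt_of_pow_lt_pow_left₀ 2 (by positivity) hsq

/-! ### The linear structure maps -/

/-- The scaled coordinate map `X ↦ (X_{i,k}/L)_{(i,k)} ∈ ℝ^{3N}` as a continuous linear map, through which
`toUnitTorusN L = proj ∘ e`, with `‖e X‖ ≤ √(3N) ‖X‖ / L`. [folklore] -/
theorem exists_scaledCoordCLM (hL : 0 < L) :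
    ∃ e : Config N →L[ℝ] EuclideanSpace ℝ (Fin N × Fin 3),
      (∀ X : Config N, toUnitTorusN L X = proj (e X)) ∧ ∀ X : Config N, ‖e X‖ ≤ Real.sqrt (3 * N) / L * ‖X‖ := by
  set f : Config N →ₗ[ℝ] EuclideanSpace ℝ (Fin N × Fin 3) :=
    { toFun := fun X => WithLp.toLp 2 fun p : Fin N × Fin 3 => X p.1 p.2 / L
      map_add' := fun X Y => by ext p; simp [add_div]
      map_smul' := fun c X => by ext p; simp [mul_div_assoc] } with hf
  refine ⟨LinearMap.toContinuousLinearMap f, fun X => ?_, fun X => ?_⟩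
  · funext p
    rw [toUnitTorusN_apply, proj_apply]
    rfl
  · have hsq : ‖(LinearMap.toContinuousLinearMap f) X‖ ^ 2 ≤ (Real.sqrt (3 * N) / L * ‖X‖) ^ 2 := by
      rw [LinearMap.coe_toContinuousLinearMap', EuclideanSpace.norm_sq_eq]
      simp only [hf, LinearMap.coe_mk, AddHom.coe_mk, PiLp.toLp_apply, Real.norm_eq_abs, sq_abs]
      have hterm : ∀ p : Fin N × Fin 3, (X p.1 p.2 / L) ^ 2 ≤ (‖X‖ / L) ^ 2 := fun p => by
        rw [div_pow, div_pow]
        refine div_le_div_of_nonneg_right ?_ (by positivity)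
        calc (X p.1 p.2) ^ 2 ≤ ‖X p.1‖ ^ 2 := sq_apply_le_norm_sq (X p.1) p.2
          _ ≤ ‖X‖ ^ 2 := pow_le_pow_left₀ (norm_nonneg _) (norm_le_pi_norm X p.1) 2
      calc ∑ p : Fin N × Fin 3, (X p.1 p.2 / L) ^ 2 ≤ ∑ _p : Fin N × Fin 3, (‖X‖ / L) ^ 2 :=
            Finset.sum_le_sum fun p _ => hterm p
        _ = (Real.sqrt (3 * N) / L * ‖X‖) ^ 2 := by
            rw [Finset.sum_const, Finset.card_univ, Fintype.card_prod, Fintype.card_fin, Fintype.card_fin]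
            simp only [nsmul_eq_mul, div_pow, mul_pow, Real.sq_sqrt (show (0 : ℝ) ≤ 3 * N by positivity)]
            push_cast
            ring
    exact (pow_le_pow_iff_left₀ (norm_nonneg _) (by positivity) two_ne_zero).1 hsq

/-- The covering map kills the generators of the period lattice. [folklore] -/
theorem toUnitTorusN_single_single (hL : L ≠ 0) (i : Fin N) (k : Fin 3) :
    toUnitTorusN L (Pi.single i (EuclideanSpace.single k L) : Config N) = 0 := by
  funext p
  rw [toUnitTorusN_apply, Pi.zero_apply]
  rcases eq_or_ne p.1 i with h1 | h1
  · rw [h1, Pi.single_eq_same, PiLp.single_apply]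
    split_ifs
    · rw [div_self hL]; exact AddCircle.coe_period 1
    · rw [zero_div]; rfl
  · rw [Pi.single_eq_of_ne h1]
    simp only [PiLp.zero_apply, zero_div]
    rfl

/-- Relabelling the particles (`relabelCLM σ : X ↦ X ∘ σ`) has norm `≤ 1` (sup norm). [folklore] -/
theorem norm_relabelCLM_le (σ : Equiv.Perm (Fin N)) : ‖relabelCLM σ‖ ≤ 1 := by
  refine ContinuousLinearMap.opNorm_le_bound _ zero_le_one fun X => ?_
  rw [one_mul, relabelCLM_apply, pi_norm_le_iff_of_nonneg (norm_nonneg _)]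
  intro i
  exact norm_le_pi_norm X (σ i)

end HardLayerAux

open HardLayerAux

/-- **Smooth symmetric periodic cut-offs vanishing near the hard configurations.** For `L > 0` there is `C ≥ 0` such
that for every `0 < s ≤ L` there is `ξ : (ℝ³)^N → ℝ` with: `ξ` is `C¹`, torus periodic and permutation symmetric,
`0 ≤ ξ ≤ 1`, `ξ = 0` on `hardLayer v L (s/2)`, `ξ = 1` at every configuration each of whose particles is within
`s/10` of a configuration off `hardLayer v L s`, and `‖∇ξ‖ ≤ C/s` everywhere. [folklore] -/
theorem exists_hardLayer_cutoff (hL : 0 < L) (v : ℝ → ℝ≥0∞) :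
    ∃ C : ℝ, 0 ≤ C ∧ ∀ s : ℝ, 0 < s → s ≤ L →
      ∃ ξ : Config N → ℝ, ContDiff ℝ 1 ξ ∧ IsTorusPeriodic L ξ ∧
        (∀ (σ : Equiv.Perm (Fin N)) (X : Config N), ξ (X ∘ σ) = ξ X) ∧
        (∀ X, 0 ≤ ξ X ∧ ξ X ≤ 1) ∧ (∀ X ∈ (hardLayer v L (s / 2) : Set (Config N)), ξ X = 0) ∧
        (∀ X ∉ (hardLayer v L s : Set (Config N)), ∀ X' : Config N, (∀ i, ‖X' i - X i‖ < s / 10) → ξ X' = 1) ∧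
        ∀ X, ‖fderiv ℝ ξ X‖ ≤ C / s := by
  classical
  obtain ⟨e, he, henorm⟩ := exists_scaledCoordCLM (N := N) hL
  set c₁ : ℝ := derivProfileMass (Fin N × Fin 3) 1 with hc₁
  have hc₁0 : 0 ≤ c₁ := derivProfileMass_nonneg _
  refine ⟨100 * c₁ * Real.sqrt (3 * N), by positivity, fun s hs hsL => ?_⟩
  -- the scale and the plateau cut-off on the torus
  set δ : ℝ := s / (100 * L) with hδ
  have hδ0 : 0 < δ := by positivity
  have hδ4 : δ ≤ 1 / 4 := by
    rw [hδ, div_le_iff₀ (by positivity)]; linarith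
  have hLδ : 2 * L * (5 * δ) = s / 10 := by rw [hδ]; field_simp; ring
  set ST : Set (UnitAddTorus (Fin N × Fin 3)) := {t | fromUnitTorusN L t ∈ (hardLayer v L (s / 2) : Set (Config N))}
    with hST
  obtain ⟨χ, hχs, hχ01, hχ1, hχ0, hχD⟩ := exists_plateau_cutoff ST hδ0 hδ4
  -- membership in `ST` of a covering point
  have hmemST : ∀ Y : Config N, toUnitTorusN L Y ∈ ST ↔ Y ∈ (hardLayer v L (s / 2) : Set (Config N)) := by
    intro Y
    obtain ⟨m, hm⟩ := exists_fromUnitTorusN_toUnitTorusN_eq hL Y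
    simp only [hST, mem_setOf_eq, hm]
    exact add_latticeVecN_mem_hardLayer_iff Y m _
  -- the unsymmetrised cut-off
  set ξ₀ : Config N → ℝ := fun X => 1 - χ (toUnitTorusN L X) with hξ₀
  have hξ₀eq : ξ₀ = fun X => 1 - lift χ (e X) := by
    funext X; simp only [hξ₀, lift_apply, he]
  have hχdiff : ContDiff ℝ ∞ (lift χ) := hχs
  have hξ₀diff : ContDiff ℝ ∞ ξ₀ := by
    rw [hξ₀eq]; exact contDiff_const.sub (hχdiff.comp e.contDiff)
  have hξ₀01 : ∀ X, 0 ≤ ξ₀ X ∧ ξ₀ X ≤ 1 := fun X => by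
    have := hχ01 (toUnitTorusN L X)
    exact ⟨by simp only [hξ₀]; linarith [this.2], by simp only [hξ₀]; linarith [this.1]⟩
  have hξ₀zero : ∀ X ∈ (hardLayer v L (s / 2) : Set (Config N)), ξ₀ X = 0 := by
    intro X hX
    simp only [hξ₀]
    rw [hχ1 _ (self_subset_thickening hδ0 ST ((hmemST X).2 hX)), sub_self]
  have hξ₀one : ∀ X ∉ (hardLayer v L s : Set (Config N)), ∀ X' : Config N, (∀ i, ‖X' i - X i‖ < s / 10) →
      ξ₀ X' = 1 := by
    intro X hX X' hX'
    simp only [hξ₀]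
    rw [hχ0 _ ?_, sub_zero]
    intro hmem
    rw [mem_thickening_iff] at hmem
    obtain ⟨t'', ht'', hdist⟩ := hmem
    obtain ⟨X'', hX''t, hX''near⟩ := exists_lift_near hL X' (by positivity) hdist
    have hX''mem : X'' ∈ (hardLayer v L (s / 2) : Set (Config N)) := (hmemST X'').1 (hX''t ▸ ht'')
    have h1 : X' ∈ (hardLayer v L (s / 2 + 2 * (s / 10)) : Set (Config N)) :=
      mem_hardLayer_of_near hX''mem fun i => by rw [← hLδ]; exact (hX''near i).le
    have h2 : X ∈ (hardLayer v L (s / 2 + 2 * (s / 10) + 2 * (s / 10)) : Set (Config N)) :=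
      mem_hardLayer_of_near h1 fun i => by rw [norm_sub_rev]; exact (hX' i).le
    exact hX (hardLayer_mono v L (by linarith) h2)
  have hξ₀per : ∀ (Y : Config N) (i : Fin N) (k : Fin 3), ξ₀ (Y + Pi.single i (EuclideanSpace.single k L)) = ξ₀ Y := by
    intro Y i k
    simp only [hξ₀]
    rw [toUnitTorusN_add, toUnitTorusN_single_single hL.ne', add_zero]
  have hξ₀D : ∀ X, ‖fderiv ℝ ξ₀ X‖ ≤ 100 * c₁ * Real.sqrt (3 * N) / s := by
    intro X
    have h1 : HasFDerivAt (fun X => lift χ (e X)) ((fderiv ℝ (lift χ) (e X)).comp e) X :=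
      (hχdiff.differentiable (by simp)).differentiableAt.hasFDerivAt.comp X e.hasFDerivAt
    have h2 : HasFDerivAt ξ₀ (0 - (fderiv ℝ (lift χ) (e X)).comp e) X := by
      rw [hξ₀eq]; exact (hasFDerivAt_const 1 X).sub h1
    rw [h2.fderiv, zero_sub, norm_neg]
    have h3 : ‖fderiv ℝ (lift χ) (e X)‖ ≤ c₁ * (δ ^ 1)⁻¹ := by
      rw [← norm_iteratedFDeriv_zero (𝕜 := ℝ) (f := fderiv ℝ (lift χ)), norm_iteratedFDeriv_fderiv]
      exact hχD 1 (e X)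
    have h4 : ‖e‖ ≤ Real.sqrt (3 * N) / L :=
      ContinuousLinearMap.opNorm_le_bound _ (by positivity) henorm
    calc ‖(fderiv ℝ (lift χ) (e X)).comp e‖ ≤ ‖fderiv ℝ (lift χ) (e X)‖ * ‖e‖ := ContinuousLinearMap.opNorm_comp_le _ _
      _ ≤ c₁ * (δ ^ 1)⁻¹ * (Real.sqrt (3 * N) / L) :=
          mul_le_mul h3 h4 (norm_nonneg _) (mul_nonneg hc₁0 (by positivity))
      _ = 100 * c₁ * Real.sqrt (3 * N) / s := by rw [hδ, pow_one]; field_simp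
  -- symmetrise
  set M : ℕ := Fintype.card (Equiv.Perm (Fin N)) with hM
  have hM0 : 0 < (M : ℝ) := by exact_mod_cast Fintype.card_pos
  set ξ : Config N → ℝ := fun X => (∑ σ : Equiv.Perm (Fin N), ξ₀ (X ∘ σ)) / M with hξ
  have hξeq : ξ = fun X => (M : ℝ)⁻¹ • ∑ σ : Equiv.Perm (Fin N), (ξ₀ ∘ relabelCLM σ) X := by
    funext X
    simp only [hξ, smul_eq_mul, Function.comp_apply, relabelCLM_apply]
    rw [div_eq_inv_mul]
  refine ⟨ξ, ?_, ?_, ?_, ?_, ?_, ?_, ?_⟩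
  · -- `C¹`
    rw [hξeq]
    refine ContDiff.const_smul _ (ContDiff.sum fun σ _ => ?_)
    exact (hξ₀diff.comp (relabelCLM σ).contDiff).of_le (by exact_mod_cast le_top)
  · -- periodic
    intro X i k
    simp only [hξ]
    congr 1
    refine Finset.sum_congr rfl fun σ _ => ?_
    rw [show (X + Pi.single i (EuclideanSpace.single k L)) ∘ σ = X ∘ σ + (Pi.single i (EuclideanSpace.single k L)) ∘ σ
      from rfl, single_comp_perm]
    exact hξ₀per _ _ _
  · -- symmetric
    intro τ X
    simp only [hξ]
    congr 1
    have h : ∀ σ : Equiv.Perm (Fin N), (X ∘ τ) ∘ σ = X ∘ ⇑(τ * σ) := fun σ => by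
      rw [Equiv.Perm.coe_mul]; rfl
    simp only [h]
    exact Equiv.sum_comp (Equiv.mulLeft τ) (fun σ => ξ₀ (X ∘ σ))
  · -- values in `[0, 1]`
    intro X
    simp only [hξ]
    refine ⟨div_nonneg (Finset.sum_nonneg fun σ _ => (hξ₀01 _).1) hM0.le, ?_⟩
    rw [div_le_one hM0]
    calc ∑ σ : Equiv.Perm (Fin N), ξ₀ (X ∘ σ) ≤ ∑ _σ : Equiv.Perm (Fin N), (1 : ℝ) :=
          Finset.sum_le_sum fun σ _ => (hξ₀01 _).2
      _ = M := by rw [Finset.sum_const, Finset.card_univ, nsmul_eq_mul, mul_one]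
  · -- vanishing on the inner layer
    intro X hX
    simp only [hξ]
    rw [Finset.sum_eq_zero fun (σ : Equiv.Perm (Fin N)) _ => hξ₀zero _ ((comp_perm_mem_hardLayer_iff σ X _).2 hX),
      zero_div]
  · -- plateau near the complement of the outer layer
    intro X hX X' hX'
    simp only [hξ]
    rw [Finset.sum_congr rfl fun (σ : Equiv.Perm (Fin N)) _ =>
      hξ₀one (X ∘ σ) (fun h => hX ((comp_perm_mem_hardLayer_iff σ X _).1 h)) (X' ∘ σ) (fun i => hX' (σ i)),
      Finset.sum_const, Finset.card_univ, nsmul_eq_mul, mul_one, div_self hM0.ne']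
  · -- gradient bound
    intro X
    have hdiff : ∀ σ : Equiv.Perm (Fin N), HasFDerivAt (ξ₀ ∘ relabelCLM σ)
        ((fderiv ℝ ξ₀ (relabelCLM σ X)).comp (relabelCLM σ)) X := fun σ =>
      (hξ₀diff.differentiable (by simp)).differentiableAt.hasFDerivAt.comp X (relabelCLM σ).hasFDerivAt
    have hsum : HasFDerivAt (fun X => ∑ σ : Equiv.Perm (Fin N), (ξ₀ ∘ relabelCLM σ) X)
        (∑ σ : Equiv.Perm (Fin N), (fderiv ℝ ξ₀ (relabelCLM σ X)).comp (relabelCLM σ)) X := by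
      have h := HasFDerivAt.sum (u := Finset.univ) fun (σ : Equiv.Perm (Fin N)) _ => hdiff σ
      rw [Finset.sum_fn] at h
      exact h
    have hξ' : HasFDerivAt ξ ((M : ℝ)⁻¹ • ∑ σ : Equiv.Perm (Fin N),
        (fderiv ℝ ξ₀ (relabelCLM σ X)).comp (relabelCLM σ)) X := by
      rw [hξeq]; exact hsum.const_smul ((M : ℝ)⁻¹)
    rw [hξ'.fderiv, norm_smul, norm_inv, Real.norm_natCast]
    calc (M : ℝ)⁻¹ * ‖∑ σ : Equiv.Perm (Fin N), (fderiv ℝ ξ₀ (relabelCLM σ X)).comp (relabelCLM σ)‖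
        ≤ (M : ℝ)⁻¹ * ∑ σ : Equiv.Perm (Fin N), ‖(fderiv ℝ ξ₀ (relabelCLM σ X)).comp (relabelCLM σ)‖ := by
          gcongr; exact norm_sum_le _ _
      _ ≤ (M : ℝ)⁻¹ * ∑ _σ : Equiv.Perm (Fin N), (100 * c₁ * Real.sqrt (3 * N) / s) := by
          gcongr with σ
          calc ‖(fderiv ℝ ξ₀ (relabelCLM σ X)).comp (relabelCLM σ)‖
              ≤ ‖fderiv ℝ ξ₀ (relabelCLM σ X)‖ * ‖relabelCLM σ‖ := ContinuousLinearMap.opNorm_comp_le _ _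
            _ ≤ 100 * c₁ * Real.sqrt (3 * N) / s * 1 :=
                mul_le_mul (hξ₀D _) (norm_relabelCLM_le σ) (norm_nonneg _) (by positivity)
            _ = _ := mul_one _
      _ = 100 * c₁ * Real.sqrt (3 * N) / s := by
          rw [Finset.sum_const, Finset.card_univ, nsmul_eq_mul, ← hM, ← mul_assoc, inv_mul_cancel₀ hM0.ne', one_mul]

end Literature.MathematicalPhysics.QuantumManyBody.BoseGas

end
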